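import Literature.AlgebraicGeometry.Resolution.CohenMacaulayAvoidance
import Literature.RingTheory.KrullDimension.AffineCatenary
import Mathlib.RingTheory.RegularLocalRing.Polynomial
import Mathlib.RingTheory.Ideal.AssociatedPrime.Localization
import Mathlib.RingTheory.Ideal.KrullsHeightTheorem
import Mathlib.RingTheory.KrullDimension.Regular
import Mathlib.RingTheory.LocalProperties.Basic
import Mathlib.Algebra.Module.LocalizedModule.Submodule
import HarnessLib

/-!
# Macaulay's unmixedness theorem at a prime, for sequences avoiding associated primes

`Literature/NumberTheory/Transcendental/NesterenkoLocalUnmixed.lean` — proofs only. The piece of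
commutative algebra invoked as "Macaulay's theorem" in the chain construction of LNM 1752 Ch. 10
Prop. 3.6 (p. 159: "all primary components of `𝔞_{n+1} = (E₀, …, E_{n+1})` contained in `𝔭`
have dimension `m − n − 2`"), in the form in which it is used there: the generators are chosen one
at a time, each outside every associated prime (contained in `𝔭`) of the ideal generated by the
previous ones.

MAIN RESULTS (`S` a regular ring, e.g. `ℚ[x₀, …, x_m]`; `𝔭 ⊂ S` prime; `E = (E₁, …, E_k)` a list of
elements of `𝔭` such that each `E_{i+1}` lies in no minimal prime `𝔮 ⊆ 𝔭` of `(E₁, …, E_i)`):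
* `height_eq_length_of_mem_minimalPrimes_of_avoids` — every minimal prime `𝔮 ⊆ 𝔭` of `(E)` has
  height `k` (elementary: heights climb by one at each step, and Krull's height theorem);
* `mem_minimalPrimes_of_mem_associatedPrimes_of_avoids` — **unmixedness**: every associated prime
  `𝔮 ⊆ 𝔭` of `(E)` is minimal (localise at `𝔭`: `S_𝔭` is regular local, hence Cohen–Macaulay; the
  images of `E` avoid minimal primes, so they form a regular sequence, which extends to a maximal
  one `E, y₁, …, y_{d−k}`; the `yᵢ` are regular on `S_𝔭/(E)`, so every associated prime of
  `S_𝔭/(E)` has coheight `≥ d − k = dim S_𝔭/(E)` and is therefore minimal);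
* `ringKrullDim_quotient_eq_of_mem_associatedPrimes_of_avoids` — for `S = ℚ[x₀, …, x_m]`: every
  associated prime `𝔮 ⊆ 𝔭` of `(E)` is minimal with `dim ℚ[x̲]/𝔮 = m + 1 − k` (the tree's "rank").

## References

* [NesterenkoPhilippon2001] LNM 1752, Ch. 10 §3, proof of Prop. 3.6, conditions 2)–3) (pp. 157–159).
* [Matsumura1987] H. Matsumura, *Commutative Ring Theory*, Thm. 17.4, 17.6 (Macaulay), 17.8.
-/

noncomputable section

open IsLocalRing RingTheory.Sequence

namespace Literature.NumberTheory.Transcendental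

namespace Nesterenko

open Literature.AlgebraicGeometry.Resolution

universe u

/-! ### Associated primes of `R ⧸ I`: the submodule and the module formulation agree -/

/-- For an ideal `I`, the associated primes of the submodule `I ⊆ R` (radicals of colon ideals
`(I : x)`) are the associated primes of the module `R ⧸ I`. [folklore] -/
theorem mem_associatedPrimes_quotient_iff {R : Type*} [CommRing R] (I 𝔮 : Ideal R) :
    𝔮 ∈ associatedPrimes R (R ⧸ I) ↔ 𝔮 ∈ (I : Submodule R R).associatedPrimes := by
  have hcolon : ∀ x : R, Submodule.colon (⊥ : Submodule R (R ⧸ I)) {Ideal.Quotient.mk I x} =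
      Submodule.colon I {x} := fun x => by
    ext y
    rw [Submodule.mem_colon_singleton, Submodule.mem_colon_singleton, Submodule.mem_bot,
      smul_eq_mul, ← Ideal.Quotient.eq_zero_iff_mem, map_mul, Algebra.smul_def,
      Ideal.Quotient.algebraMap_eq]
  rw [AssociatedPrimes.mem_iff, IsAssociatedPrime, Submodule.isAssociatedPrime_def,
    Submodule.AssociatePrimes.mem_iff, Submodule.isAssociatedPrime_def]
  constructor
  · rintro ⟨h𝔮, x, hx⟩
    obtain ⟨x, rfl⟩ := Ideal.Quotient.mk_surjective x
    exact ⟨h𝔮, x, by rw [hx, hcolon]⟩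
  · rintro ⟨h𝔮, x, hx⟩
    exact ⟨h𝔮, Ideal.Quotient.mk I x, by rw [hx, hcolon]⟩

/-! ### Local part: Cohen–Macaulay local rings -/

section Local

variable {R : Type u} [CommRing R] [IsLocalRing R] [IsNoetherianRing R]

/-- The coheight of a prime containing `I` is at most `dim R/I`. [folklore] -/
theorem coheight_le_ringKrullDim_quotient {R : Type*} [CommRing R] {I : Ideal R}
    (p : PrimeSpectrum R) (h : I ≤ p.asIdeal) :
    (Order.coheight p : WithBot ℕ∞) ≤ ringKrullDim (R ⧸ I) := by
  rw [ringKrullDim_quotient, Order.coheight_eq_krullDim_Ici]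
  have hsub : Set.Ici p ⊆ PrimeSpectrum.zeroLocus (R := R) I := fun q hq =>
    (PrimeSpectrum.mem_zeroLocus _ _).mpr (fun x hx => ((PrimeSpectrum.asIdeal_le_asIdeal p q).mpr hq) (h hx))
  exact Order.krullDim_le_of_strictMono (fun q => ⟨q.1, hsub q.2⟩) fun a b hab => hab

/-- In a Noetherian local ring, for a list `L` with `|L| < dim R` there is `y ∈ 𝔪` outside every
minimal prime of `(L)` (Krull's height theorem and prime avoidance). [folklore] -/
theorem exists_mem_maximalIdeal_notMem_minimalPrimes (L : List R)
    (hlen : (L.length : WithBot ℕ∞) < ringKrullDim R) :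
    ∃ y ∈ maximalIdeal R, ∀ p ∈ (Ideal.ofList L).minimalPrimes, y ∉ p := by
  classical
  have hfin : (Ideal.ofList L).minimalPrimes.Finite := Ideal.finite_minimalPrimes_of_isNoetherianRing R _
  -- no minimal prime of `(L)` is `𝔪`
  have hne : ∀ p ∈ (Ideal.ofList L).minimalPrimes, ¬ maximalIdeal R ≤ p := by
    intro p hp hle
    have hpm : p = maximalIdeal R :=
      ((IsLocalRing.maximalIdeal.isMaximal R).eq_of_le hp.1.1.ne_top hle).symm
    have h1 : p.height ≤ L.length := by
      have hs : ({x | x ∈ L} : Set R).Finite := L.finite_toSet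
      have h := Ideal.height_le_card_of_mem_minimalPrimes_span hs hp
      refine h.trans ?_
      have : ({x | x ∈ L} : Set R) = ↑L.toFinset := by ext; simp
      rw [this, Set.ncard_coe_finset]
      exact_mod_cast L.toFinset_card_le
    have h2 : (maximalIdeal R).height = ringKrullDim R := IsLocalRing.maximalIdeal_height_eq_ringKrullDim
    rw [hpm] at h1
    have : ringKrullDim R ≤ (L.length : WithBot ℕ∞) := by
      rw [← h2]; exact_mod_cast h1
    exact absurd hlen (not_lt.mpr this)
  -- prime avoidance
  by_contra hcon
  push Not at hcon
  have hsub : ((maximalIdeal R : Ideal R) : Set R) ⊆ ⋃ p ∈ (hfin.toFinset : Set (Ideal R)), (p : Set R) := by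
    intro y hy
    obtain ⟨p, hp, hyp⟩ := hcon y hy
    exact Set.mem_biUnion (hfin.mem_toFinset.mpr hp) hyp
  obtain ⟨p, hp, hle⟩ := (Ideal.subset_union_prime (⊤ : Ideal R) (⊤ : Ideal R) (f := fun p : Ideal R => p)
    (fun p hp _ _ => (hfin.mem_toFinset.mp hp).1.1)).mp hsub
  exact hne p (hfin.mem_toFinset.mp hp) hle

/-- Appending an element that avoids the minimal primes of `(Q)` preserves the avoidance property.
[folklore] -/
theorem avoidsMinimalPrimes_append_singleton {R : Type u} [CommRing R] {Q : List R}
    (hQ : AvoidsMinimalPrimes Q) {y : R} (hy : ∀ p ∈ (Ideal.ofList Q).minimalPrimes, y ∉ p) :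
    AvoidsMinimalPrimes (Q ++ [y]) := by
  intro L₁ q L₂ h p hp
  rcases List.eq_nil_or_concat L₂ with rfl | ⟨L₂', z, rfl⟩
  · obtain ⟨h1, h2⟩ := List.append_inj' h rfl
    have hq : q = y := by simpa using h2.symm
    subst h1; rw [hq]; exact hy p hp
  · have h' : Q ++ [y] = (L₁ ++ q :: L₂') ++ [z] := by rw [h]; simp
    obtain ⟨h1, -⟩ := List.append_inj' h' rfl
    exact hQ L₁ q L₂' h1 p hp

/-- **Extension to a maximal avoiding sequence**: in a Noetherian local ring of dimension `d`, a
sequence `Q ⊂ 𝔪` avoiding minimal primes extends to one of length `d`. [folklore] -/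
theorem exists_avoidsMinimalPrimes_append {d : ℕ} (hd : ringKrullDim R = d) :
    ∀ (n : ℕ) (Q : List R), AvoidsMinimalPrimes Q → (∀ q ∈ Q, q ∈ maximalIdeal R) →
      Q.length + n = d →
      ∃ Q' : List R, AvoidsMinimalPrimes (Q ++ Q') ∧ (∀ q ∈ Q', q ∈ maximalIdeal R) ∧
        (Q ++ Q').length = d := by
  intro n
  induction n with
  | zero =>
    intro Q hQ hQm hlen
    exact ⟨[], by simpa using hQ, by simp, by simpa using hlen⟩
  | succ n ih =>
    intro Q hQ hQm hlen
    have hlt : (Q.length : WithBot ℕ∞) < ringKrullDim R := by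
      rw [hd]; exact_mod_cast (by omega : Q.length < d)
    obtain ⟨y, hym, hy⟩ := exists_mem_maximalIdeal_notMem_minimalPrimes Q hlt
    obtain ⟨Q', h1, h2, h3⟩ := ih (Q ++ [y]) (avoidsMinimalPrimes_append_singleton hQ hy)
      (fun q hq => by
        rcases List.mem_append.mp hq with hq | hq
        · exact hQm q hq
        · rw [List.mem_singleton.mp hq]; exact hym)
      (by simp; omega)
    refine ⟨y :: Q', by simpa using h1, fun q hq => ?_, by simpa using h3⟩
    rcases List.mem_cons.mp hq with rfl | hq
    · exact hym
    · exact h2 q hq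

/-- **Macaulay's unmixedness theorem (local form)**: in a Noetherian local ring with a regular
sequence in `𝔪` of length `dim R` (Cohen–Macaulay), for a sequence `E ⊂ 𝔪` avoiding minimal
primes, every associated prime of `R/(E)` is a minimal prime of `(E)`.
[cite: Matsumura1987, Thm. 17.4 (iii) and Thm. 17.6] -/
theorem mem_minimalPrimes_of_mem_associatedPrimes_local {rs : List R} (hrs : IsRegular R rs)
    (hmem : ∀ r ∈ rs, r ∈ maximalIdeal R) (hdim : (rs.length : WithBot ℕ∞) = ringKrullDim R)
    {E : List R} (hEm : ∀ e ∈ E, e ∈ maximalIdeal R) (hE : AvoidsMinimalPrimes E)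
    {p : Ideal R} (hp : p ∈ associatedPrimes R (R ⧸ Ideal.ofList E)) :
    p ∈ (Ideal.ofList E).minimalPrimes := by
  classical
  set d := rs.length with hd
  have hEreg : IsRegular R E := isRegular_of_forall_notMem_minimalPrimes hrs hmem hdim hEm hE
  -- `dim R/(E) + |E| = d`
  have hdimE := ringKrullDim_add_length_eq_ringKrullDim_of_isRegular E hEreg
  rw [← hdim] at hdimE
  have hI_ne : Ideal.ofList E ≠ ⊤ := fun h =>
    IsLocalRing.maximalIdeal.isMaximal R |>.ne_top (top_le_iff.mp (h ▸ Ideal.span_le.mpr fun x hx => hEm x hx))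
  haveI : Nontrivial (R ⧸ Ideal.ofList E) := Ideal.Quotient.nontrivial_iff.mpr hI_ne
  obtain ⟨c, hc⟩ : ∃ c : ℕ, ringKrullDim (R ⧸ Ideal.ofList E) = c := by
    have h0 : (0 : WithBot ℕ∞) ≤ ringKrullDim (R ⧸ Ideal.ofList E) := ringKrullDim_nonneg_of_nontrivial
    have h1 : ringKrullDim (R ⧸ Ideal.ofList E) ≤ d := by
      rw [← hdimE]; exact le_add_of_nonneg_right (by positivity)
    generalize ringKrullDim (R ⧸ Ideal.ofList E) = x at h0 h1
    induction x with
    | bot => exact absurd h0 (by simp)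
    | coe x =>
      induction x with
      | top => exact absurd (top_le_iff.mp (WithBot.coe_le_coe.mp h1)) (ENat.coe_ne_top d)
      | coe n => exact ⟨n, rfl⟩
  have hck : c + E.length = d := by
    rw [hc] at hdimE
    exact_mod_cast hdimE
  -- extend `E` to a maximal avoiding (hence regular) sequence `E ++ Q'`
  obtain ⟨Q', hav, hQ'm, hlen⟩ := exists_avoidsMinimalPrimes_append hdim.symm c E hE hEm (by omega)
  have hreg : IsRegular R (E ++ Q') :=
    isRegular_of_forall_notMem_minimalPrimes hrs hmem hdim (fun q hq => by
      rcases List.mem_append.mp hq with hq | hq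
      · exact hEm q hq
      · exact hQ'm q hq) hav
  have hQ'len : Q'.length = c := by
    rw [List.length_append] at hlen; omega
  -- `Q'` is regular on `R/(E)`
  set M' := R ⧸ (Ideal.ofList E • ⊤ : Submodule R R) with hM'
  have hwk : IsWeaklyRegular M' Q' := ((isWeaklyRegular_append_iff R E Q').mp hreg.toIsWeaklyRegular).2
  have hEtop : (Ideal.ofList E • ⊤ : Submodule R R) = (Ideal.ofList E : Submodule R R) := by
    rw [Ideal.smul_eq_mul, Ideal.mul_top]
  haveI : Nontrivial M' := by
    rw [hM', hEtop]
    exact Ideal.Quotient.nontrivial_iff.mpr hI_ne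
  have hQ'reg : IsRegular M' Q' :=
    (IsLocalRing.isRegular_iff_isWeaklyRegular_of_subset_maximalIdeal hQ'm).mpr hwk
  -- transport `p` to `M'`
  have e : (R ⧸ Ideal.ofList E) ≃ₗ[R] M' := Submodule.quotEquivOfEq _ _ hEtop.symm
  have hp' : p ∈ associatedPrimes R M' := by
    rw [← LinearEquiv.AssociatedPrimes.eq e]; exact hp
  have hpprime : p.IsPrime := IsAssociatedPrime.isPrime hp
  have hcoh := length_le_coheight_of_mem_associatedPrimes hQ'reg hQ'm hp'
  rw [hQ'len] at hcoh
  -- `p ⊇ (E)`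
  have hpE : Ideal.ofList E ≤ p := by
    have h := IsAssociatedPrime.annihilator_le hp
    rwa [Submodule.annihilator_top, Ideal.annihilator_quotient] at h
  -- if `p` were not minimal, a minimal prime `p₀ < p` would have coheight `≥ c + 1 > dim R/(E)`
  by_contra hnot
  obtain ⟨p₀, hp₀, hp₀p⟩ := Ideal.exists_minimalPrimes_le hpE
  have hne : p₀ ≠ p := fun h => hnot (h ▸ hp₀)
  have hlt : (⟨p₀, hp₀.1.1⟩ : PrimeSpectrum R) < ⟨p, hpprime⟩ := lt_of_le_of_ne hp₀p (fun h => hne (by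
    simpa using congrArg PrimeSpectrum.asIdeal h))
  have h1 := Order.coheight_add_one_le hlt
  have h2 := coheight_le_ringKrullDim_quotient (I := Ideal.ofList E) (⟨p₀, hp₀.1.1⟩ : PrimeSpectrum R) hp₀.1.2
  rw [hc] at h2
  have h2' : Order.coheight (⟨p₀, hp₀.1.1⟩ : PrimeSpectrum R) ≤ c := by exact_mod_cast h2
  have : (c : ℕ∞) + 1 ≤ c := (add_le_add hcoh (le_refl (1 : ℕ∞))).trans (h1.trans h2')
  exact absurd this (not_le.mpr (ENat.lt_add_one_iff (ENat.coe_ne_top c) |>.mpr le_rfl))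

end Local

/-! ### Heights along an avoiding sequence -/

/-- **Heights climb by one at each step**: if each `E_{i+1}` lies outside every minimal prime
`𝔮 ⊆ 𝔭` of `(E₁, …, E_i)`, then every minimal prime `𝔮 ⊆ 𝔭` of `(E)` has height `|E|`
(`≥` by induction, `≤` by Krull's height theorem). [folklore] -/
theorem height_eq_length_of_mem_minimalPrimes_of_avoids {S : Type*} [CommRing S] [IsNoetherianRing S]
    (𝔭 : Ideal S) :
    ∀ (E : List S), (∀ (L₁ : List S) (e : S) (L₂ : List S), E = L₁ ++ e :: L₂ →
        ∀ 𝔮 ∈ (Ideal.ofList L₁).minimalPrimes, 𝔮 ≤ 𝔭 → e ∉ 𝔮) →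
      ∀ {𝔮 : Ideal S}, 𝔮 ∈ (Ideal.ofList E).minimalPrimes → 𝔮 ≤ 𝔭 → 𝔮.height = E.length := by
  intro E
  induction E using List.reverseRecOn with
  | nil =>
    intro _ 𝔮 h𝔮 _
    have : Ideal.ofList ([] : List S) = ⊥ := by simp
    rw [this] at h𝔮
    haveI := h𝔮.1.1
    rw [List.length_nil, Nat.cast_zero, Ideal.height_eq_zero_iff]
    exact h𝔮
  | append_singleton E₀ e ih =>
    intro havoid 𝔮 h𝔮 h𝔮𝔭
    classical
    haveI h𝔮p : 𝔮.IsPrime := h𝔮.1.1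
    have havoid₀ : ∀ (L₁ : List S) (e' : S) (L₂ : List S), E₀ = L₁ ++ e' :: L₂ →
        ∀ 𝔮 ∈ (Ideal.ofList L₁).minimalPrimes, 𝔮 ≤ 𝔭 → e' ∉ 𝔮 := fun L₁ e' L₂ h =>
      havoid L₁ e' (L₂ ++ [e]) (by rw [h]; simp)
    apply le_antisymm
    · -- Krull
      have hs : ({x | x ∈ E₀ ++ [e]} : Set S).Finite := (E₀ ++ [e]).finite_toSet
      refine (Ideal.height_le_card_of_mem_minimalPrimes_span hs h𝔮).trans ?_
      have : ({x | x ∈ E₀ ++ [e]} : Set S) = ↑(E₀ ++ [e]).toFinset := by ext; simp [or_comm]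
      rw [this, Set.ncard_coe_finset]
      exact_mod_cast (E₀ ++ [e]).toFinset_card_le
    · -- a minimal prime `𝔮₀ ⊆ 𝔮` of `(E₀)`, strictly smaller since `e ∈ 𝔮 ∖ 𝔮₀`
      have hle₀ : Ideal.ofList E₀ ≤ 𝔮 := le_trans (Ideal.span_mono fun x hx => by
        simp only [Set.mem_setOf_eq, List.mem_append] ; exact Or.inl hx) h𝔮.1.2
      obtain ⟨𝔮₀, h𝔮₀, h𝔮₀𝔮⟩ := Ideal.exists_minimalPrimes_le hle₀
      haveI : 𝔮₀.IsPrime := h𝔮₀.1.1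
      have ih' := ih havoid₀ h𝔮₀ (h𝔮₀𝔮.trans h𝔮𝔭)
      have he𝔮 : e ∈ 𝔮 := h𝔮.1.2 (Ideal.subset_span (by simp))
      have he𝔮₀ : e ∉ 𝔮₀ := havoid E₀ e [] rfl 𝔮₀ h𝔮₀ (h𝔮₀𝔮.trans h𝔮𝔭)
      have hlt : 𝔮₀ < 𝔮 := lt_of_le_of_ne h𝔮₀𝔮 (fun h => he𝔮₀ (h ▸ he𝔮))
      have hsm := Ideal.height_strict_mono_of_isPrime hlt
      rw [List.length_append, List.length_singleton, Nat.cast_add, Nat.cast_one, ← ih']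
      exact Order.add_one_le_of_lt hsm

/-! ### Global form over a regular ring -/

/-- **Macaulay's unmixedness theorem at a prime** (regular rings): let `S` be a regular ring,
`𝔭 ⊂ S` a prime, `E ⊂ 𝔭` a list such that each `E_{i+1}` lies outside every minimal prime
`𝔮 ⊆ 𝔭` of `(E₁, …, E_i)`. Then every associated prime `𝔮 ⊆ 𝔭` of `S/(E)` is a minimal prime of
`(E)`. [cite: Matsumura1987, Thm. 17.6 with Thm. 17.8] -/
theorem mem_minimalPrimes_of_mem_associatedPrimes_of_avoids {S : Type u} [CommRing S]
    [IsRegularRing S] (𝔭 : Ideal S) [h𝔭 : 𝔭.IsPrime] {E : List S} (hE𝔭 : ∀ e ∈ E, e ∈ 𝔭)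
    (havoid : ∀ (L₁ : List S) (e : S) (L₂ : List S), E = L₁ ++ e :: L₂ →
      ∀ 𝔮 ∈ (Ideal.ofList L₁).minimalPrimes, 𝔮 ≤ 𝔭 → e ∉ 𝔮)
    {𝔮 : Ideal S} (h𝔮 : 𝔮 ∈ associatedPrimes S (S ⧸ Ideal.ofList E)) (h𝔮𝔭 : 𝔮 ≤ 𝔭) :
    𝔮 ∈ (Ideal.ofList E).minimalPrimes := by
  classical
  set Rp := Localization.AtPrime 𝔭 with hRp
  set f := algebraMap S Rp with hf
  haveI : IsRegularLocalRing Rp := inferInstance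
  obtain ⟨rs, hrs, hmem, hlen⟩ := exists_isRegular_length_eq_ringKrullDim Rp
  -- the localised sequence avoids minimal primes
  set E' := E.map f with hE'
  have hE'm : ∀ e ∈ E', e ∈ maximalIdeal Rp := by
    intro e he
    obtain ⟨x, hx, rfl⟩ := List.mem_map.mp he
    exact (IsLocalization.AtPrime.to_map_mem_maximal_iff Rp 𝔭 x).mpr (hE𝔭 x hx)
  have hcomap_le : ∀ 𝔔 : Ideal Rp, 𝔔.IsPrime → 𝔔.comap f ≤ 𝔭 := fun 𝔔 h𝔔 =>
    calc 𝔔.comap f ≤ (maximalIdeal Rp).comap f := Ideal.comap_mono (IsLocalRing.le_maximalIdeal h𝔔.ne_top)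
      _ = 𝔭 := Localization.AtPrime.under_maximalIdeal
  have hE'av : AvoidsMinimalPrimes E' := by
    intro L₁' q' L₂' h 𝔔 h𝔔
    obtain ⟨L₁, M, hEM, hL₁, hM⟩ := List.map_eq_append_iff.mp h
    obtain ⟨e, L₂, hM', he, hL₂⟩ := List.map_eq_cons_iff.mp hM
    have hsplit : E = L₁ ++ e :: L₂ := by rw [hEM, hM']
    have h𝔔' : 𝔔 ∈ ((Ideal.ofList L₁).map f).minimalPrimes := by
      rwa [Ideal.map_ofList, hL₁]
    rw [IsLocalization.minimalPrimes_map 𝔭.primeCompl] at h𝔔'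
    have h1 := havoid L₁ e L₂ hsplit (𝔔.comap f) h𝔔' (hcomap_le 𝔔 h𝔔.1.1)
    rw [← he]
    exact fun h2 => h1 (Ideal.mem_comap.mpr h2)
  -- the localised prime is associated to `Rp/(E')`
  have hdisj : Disjoint (𝔭.primeCompl : Set S) (𝔮 : Set S) :=
    Set.disjoint_left.mpr fun x hx hx𝔮 => hx (h𝔮𝔭 hx𝔮)
  have h𝔮prime : 𝔮.IsPrime := IsAssociatedPrime.isPrime h𝔮
  have hcm : (𝔮.map f).comap f = 𝔮 := IsLocalization.under_map_of_isPrime_disjoint 𝔭.primeCompl Rp h𝔮prime hdisj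
  set I := Ideal.ofList E with hI
  have hloc : I.localized' Rp 𝔭.primeCompl (Algebra.linearMap S Rp) = Ideal.ofList E' := by
    rw [Ideal.localized'_eq_map, hE', ← Ideal.map_ofList]
  have hass' : 𝔮.map f ∈ associatedPrimes Rp (Rp ⧸ I.localized' Rp 𝔭.primeCompl (Algebra.linearMap S Rp)) :=
    Module.associatedPrimes.mem_associatedPrimes_of_comap_mem_associatedPrimes_of_isLocalizedModule 𝔭.primeCompl
      (I.toLocalizedQuotient' Rp 𝔭.primeCompl (Algebra.linearMap S Rp)) (𝔮.map f) (by rwa [hcm])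
  have hass : 𝔮.map f ∈ associatedPrimes Rp (Rp ⧸ Ideal.ofList E') := by
    have e : (Rp ⧸ I.localized' Rp 𝔭.primeCompl (Algebra.linearMap S Rp)) ≃ₗ[Rp] (Rp ⧸ Ideal.ofList E') :=
      Submodule.quotEquivOfEq _ _ hloc
    rw [← LinearEquiv.AssociatedPrimes.eq e]; exact hass'
  -- local unmixedness, and back
  have hmin := mem_minimalPrimes_of_mem_associatedPrimes_local hrs hmem hlen hE'm hE'av hass
  have hmin' : 𝔮.map f ∈ ((Ideal.ofList E).map f).minimalPrimes := by rwa [Ideal.map_ofList]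
  rw [IsLocalization.minimalPrimes_map 𝔭.primeCompl] at hmin'
  have : (𝔮.map f).under S = 𝔮 := hcm
  rw [← this]; exact hmin'

/-- **The form used in LNM 1752 Ch. 10 Prop. 3.6** (`S = ℚ[x₀, …, x_m]`): with `𝔭`, `E` as above,
every associated prime `𝔮 ⊆ 𝔭` of the ideal `(E)` (in the tree's `Submodule.associatedPrimes`
sense) is a minimal prime of `(E)` and `dim ℚ[x̲]/𝔮 = m + 1 − |E|`: "all primary components of
`(E₀, …, E_n)` contained in `𝔭` have the same dimension".
[cite: NesterenkoPhilippon2001, Ch. 10 §3, proof of Prop. 3.6, conditions 2)–3) (pp. 157–159)] -/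
theorem ringKrullDim_quotient_eq_of_mem_associatedPrimes_of_avoids {m : ℕ}
    (𝔭 : Ideal (MvPolynomial (Fin (m + 1)) ℚ)) [𝔭.IsPrime] {E : List (MvPolynomial (Fin (m + 1)) ℚ)}
    (hE𝔭 : ∀ e ∈ E, e ∈ 𝔭)
    (havoid : ∀ (L₁ : List _) (e : MvPolynomial (Fin (m + 1)) ℚ) (L₂ : List _), E = L₁ ++ e :: L₂ →
      ∀ 𝔮 ∈ (Ideal.ofList L₁).minimalPrimes, 𝔮 ≤ 𝔭 → e ∉ 𝔮)
    {𝔮 : Ideal (MvPolynomial (Fin (m + 1)) ℚ)}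
    (h𝔮 : 𝔮 ∈ (Ideal.ofList E : Submodule _ (MvPolynomial (Fin (m + 1)) ℚ)).associatedPrimes)
    (h𝔮𝔭 : 𝔮 ≤ 𝔭) :
    𝔮 ∈ (Ideal.ofList E).minimalPrimes ∧ E.length ≤ m + 1 ∧
      ringKrullDim (MvPolynomial (Fin (m + 1)) ℚ ⧸ 𝔮) = (m + 1 - E.length : ℕ) := by
  have h𝔮' := (mem_associatedPrimes_quotient_iff _ _).mpr h𝔮
  have hmin := mem_minimalPrimes_of_mem_associatedPrimes_of_avoids 𝔭 hE𝔭 havoid h𝔮' h𝔮𝔭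
  haveI : 𝔮.IsPrime := hmin.1.1
  have hht := height_eq_length_of_mem_minimalPrimes_of_avoids 𝔭 E havoid hmin h𝔮𝔭
  have hdim : ringKrullDim (MvPolynomial (Fin (m + 1)) ℚ) = (m + 1 : ℕ) := by
    rw [MvPolynomial.ringKrullDim_of_isNoetherianRing, ringKrullDim_eq_zero_of_field ℚ, zero_add]
    simp
  have hform := Literature.RingTheory.KrullDimension.ringKrullDim_quotient_add_height ℚ 𝔮
  rw [hdim, hht] at hform
  -- finiteness of `dim S/𝔮`
  obtain ⟨c, hc⟩ : ∃ c : ℕ, ringKrullDim (MvPolynomial (Fin (m + 1)) ℚ ⧸ 𝔮) = c := by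
    have h0 : (0 : WithBot ℕ∞) ≤ ringKrullDim (MvPolynomial (Fin (m + 1)) ℚ ⧸ 𝔮) :=
      ringKrullDim_nonneg_of_nontrivial
    have h1 : ringKrullDim (MvPolynomial (Fin (m + 1)) ℚ ⧸ 𝔮) ≤ (m + 1 : ℕ) := by
      rw [← hform]
      have h0' : (0 : WithBot ℕ∞) ≤ ((E.length : ℕ∞) : WithBot ℕ∞) := WithBot.coe_le_coe.mpr bot_le
      exact le_add_of_nonneg_right h0'
    generalize ringKrullDim (MvPolynomial (Fin (m + 1)) ℚ ⧸ 𝔮) = x at h0 h1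
    induction x with
    | bot => exact absurd h0 (by simp)
    | coe x =>
      induction x with
      | top => exact absurd (top_le_iff.mp (WithBot.coe_le_coe.mp h1)) (ENat.coe_ne_top _)
      | coe n => exact ⟨n, rfl⟩
  rw [hc] at hform ⊢
  have h' : c + E.length = m + 1 := by exact_mod_cast hform
  exact ⟨hmin, by omega, by congr 1; exact_mod_cast (by omega : c = m + 1 - E.length)⟩

end Nesterenko

end Literature.NumberTheory.Transcendental
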